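import Summits.BirchSwinnertonDyer.BirchSwinnertonDyer.Theses.SylvesterTwoHeegnerIndex
import Summits.BirchSwinnertonDyer.BirchSwinnertonDyer.Theorems.SylvesterTwoHeegnerIndexYinIndex
import Summits.BirchSwinnertonDyer.BirchSwinnertonDyer.Theorems.SylvesterTwoHeegnerIndexYinToric
import Summits.BirchSwinnertonDyer.BirchSwinnertonDyer.Theorems.SylvesterTwoHeegnerIndexCoupledUpperBoundReduction
-- ↑ K3R (two g12, p563747 ACCEPTED 2026-08-27; async audit D-0009)

/-! # Skeleton VARIANT I for crux `UpperOffV0HSYPlus` (stmt-BirchSwinnertonDyer-19804) —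
«toric + (OFFB) SPLIT BY CONGRUENCE CLASS: p ≡ 4 (9) = THEOREM K3's typed conclusion; p ≡ 7 (9) = research residual»
(planner bsd-cm-plan g24, D316–D321, 2026-08-27; supersedes VARIANT H c992468c1a8742a8 after K3R p563747 ACCEPTED).

WHY A NEW VARIANT.  ROAD (k) («𝒪-linear Kolyvagin over the CM field K = ℚ(ω) at the inert 2», line card
`Lines/cmframe-kolyvagin2.md` 619cfc94e0810c81) produced THEOREM K3 (memo two v2.18 §64–§66, refereed g61
`referee/REFEREE-ROADK-K3-G61.md` 15e1e08958e34d97, PASS on the headline): for every p ≡ 4 (9), 3 ∉ 𝔽_p^{×3}: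
ord₂ #Ш(E_p)[2^∞] + ord₂ #Ш(E_{3p²})[2^∞] ≤ 2m(p) = ord₂(#Ш_an(E_p)·#Ш_an(E_{3p²})) — a PAPER theorem modulo
PublishedFactsTwoPlus whose CONCLUSION is typable without Euler-system vocabulary (K3R:
`CoupledUpperBoundAtTwoFourModNine`) and which implies VARIANT H's (OFFB) on the p ≡ 4 (9) half through K3R's
reduction (`upperOffV0B_fourModNine_of_coupledUpperBound`, #Ш(A) = #Ш_an(A) for the rank-0 twin from the bundle).
VARIANT I therefore SPLITS (OFFB): the p ≡ 4 (9) stub IS K3's typed conclusion (paper-proved, refereed; kernel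
open), the p ≡ 7 (9) stub is the research residual (halved system, memo §64.7; HSY's point is 2Y′ + t there).

HONEST FRAMING: a skeleton (sorries only in `stub_*`); closes no item; BSD not claimed; K3 is a paper theorem,
its stub stays `sorry` until an Euler-system formalisation exists (not commissioned).
-/

set_option linter.dupNamespace false

open scoped Classical
open WeierstrassCurve Literature.NumberTheory.EllipticCurves

namespace Summit.BirchSwinnertonDyer.BirchSwinnertonDyer.Cruxes.UpperOffV0HSYPlus.OffV0CMFrame

/-- (Y) unchanged from VARIANT H. -/
theorem stub_yinHeightDisplay :
    Summit.BirchSwinnertonDyer.BirchSwinnertonDyer.Theorems.SylvesterTwoYin.YinHeightDisplay := by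
  sorry

/-- (T) unchanged from VARIANT H. -/
theorem stub_yinToricDecomposition :
    Summit.BirchSwinnertonDyer.BirchSwinnertonDyer.Theorems.SylvesterTwoYinToric.YinToricDecomposition := by
  sorry

/-- (C′) derived, as in VARIANT H. -/
theorem yinPointTwoDivisible_of_stubs :
    Summit.BirchSwinnertonDyer.BirchSwinnertonDyer.Theorems.SylvesterTwoYin.YinPointTwoDivisibleSevenModNine :=
  Summit.BirchSwinnertonDyer.BirchSwinnertonDyer.Theorems.SylvesterTwoYinToric.yinPointTwoDivisibleSevenModNine_of_toric
    ⟨stub_yinHeightDisplay, stub_yinToricDecomposition⟩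

/-- (OFFB-4) THEOREM K3's typed conclusion, granted the route's published facts (paper theorem: memo two v2.18
§64–§66, refereed g61 `referee/REFEREE-ROADK-K3-G61.md` 15e1e08958e34d97 PASS on the headline; kernel OPEN — no
Euler-system vocabulary in the tree): the COUPLED 2-part upper bound for the HSY pair (E_{3p²}, E_p) on p ≡ 4 (9),
3 non-cube (K3R's `CoupledUpperBoundAtTwoFourModNine`, fact-free analytic pair form; under the facts it is
EQUIVALENT to `MissingUpperBoundAt B 2` for every p ≡ 4 (9) member, `coupledUpperBound_iff_missingUpperBoundAt`).
Why it might fail: implied by BSD₂ on the class, so only with BSD; the paper proof's flags (h4′)/(h5).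
[sources: memo two v2.18 §57–§66; GrossLMS1991; McCallumLMS1991 §5; HuShuYin2019; referee g59/g60/g61 files] -/
theorem stub_coupledUpperBoundAtTwo_fourModNine :
    Summit.BirchSwinnertonDyer.BirchSwinnertonDyer.Theses.SylvesterTwoHeegnerIndex.PublishedFactsTwoPlus →
      Summit.BirchSwinnertonDyer.BirchSwinnertonDyer.Theorems.SylvesterTwoCoupledUpperBound.CoupledUpperBoundAtTwoFourModNine := by
  sorry

/-- (OFFB-7) research residual: VARIANT H's (OFFB) restricted to p ≡ 7 (9) (halved system; memo two §64.7). -/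
theorem stub_upperOffV0B_HSY_sevenModNine :
    Summit.BirchSwinnertonDyer.BirchSwinnertonDyer.Theses.SylvesterTwoHeegnerIndex.PublishedFactsTwoPlus →
      ∀ (p : ℕ), p.Prime → p % 9 = 7 → (¬ ∃ x : ZMod p, x ^ 3 = 3) →
        ∀ (B : WeierstrassCurve ℚ) [B.IsElliptic] [B.IsGloballyMinimal],
          (∃ C : WeierstrassCurve.VariableChange ℚ, C • B = HuShuYin2019.cubeSumCurve (p : ℚ)) →
          Nat.card (AddCommGroup.primaryComponent B.sha 2) ≠ 1 →
          Literature.NumberTheory.EllipticCurves.Rank1Residual.Typed.MissingUpperBoundAt B 2 := by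
  sorry

/-- composition (VARIANT I): the crux BY NAME through two g8's reduction `upperOffV0HSYPlus_of_yin_of_offV0B`,
with (OFFB) assembled from the two congruence halves by K3R's `upperOffV0B_of_residues` and the p ≡ 4 (9) half
supplied by K3R's `upperOffV0B_fourModNine_of_coupledUpperBound` from the (facts-conditional) K3 stub. -/
theorem UpperOffV0HSYPlus_of :
    Summit.BirchSwinnertonDyer.BirchSwinnertonDyer.Theses.SylvesterTwoHeegnerIndex.UpperOffV0HSYPlus :=
  Summit.BirchSwinnertonDyer.BirchSwinnertonDyer.Theorems.SylvesterTwoYin.upperOffV0HSYPlus_of_yin_of_offV0B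
    stub_yinHeightDisplay yinPointTwoDivisible_of_stubs
    (Summit.BirchSwinnertonDyer.BirchSwinnertonDyer.Theorems.SylvesterTwoCoupledUpperBound.upperOffV0B_of_residues
      (fun hF =>
        Summit.BirchSwinnertonDyer.BirchSwinnertonDyer.Theorems.SylvesterTwoCoupledUpperBound.upperOffV0B_fourModNine_of_coupledUpperBound
          (stub_coupledUpperBoundAtTwo_fourModNine hF) hF)
      stub_upperOffV0B_HSY_sevenModNine)

end Summit.BirchSwinnertonDyer.BirchSwinnertonDyer.Cruxes.UpperOffV0HSYPlus.OffV0CMFrame
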